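import Summits.Ventures.PercRepro.Night2LocalFatOnly
import Summits.Ventures.PercRepro.Night2LocalTwoTwoY

/-!
# PercRepro — the `(5, 3)` shadow form modulo the type `(2, 1)`, and its distance-`1` form (night-2, gen 9)

For a loopless matroid of rank `5`: the diagonal shadow form `ShadowHall M 5 3 Φ` follows from the local form
at the rank-`4` flats `G` with `|E ∖ G| = 2` that carry a layer-0 member (`|G ∖ cl B| = 1`, the type `(2, 1)`)
— the other flats with `|E ∖ G| = 2` are the type `(2, 2)` (`localShadowHall_two_two`), `|E ∖ G| = 3` is
`localShadowHall_dq_of_q_le_three`, and the rest is `shadowHall_five_three_of_two`.  The type `(2, 1)` is the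
plane statement (T21) of NIGHT-2-local.md §19.
-/

namespace PercRepro.Shadow

open Finset PerFlat ThmH

variable {α : Type*} [DecidableEq α] {M : Matroid α} [M.Finite]

open scoped Classical in
/-- **The `(5, 3)` shadow form modulo the type `(2, 1)`.** -/
theorem shadowHall_five_three_of_two_one (hl : ∀ e ∈ gr M, M.IsNonloop e)
    (hrk : M.eRk ((gr M : Finset α) : Set α) = ((5 : ℕ) : ℕ∞))
    (h21 : ∀ G ∈ flatsQ M 4, (gr M \ G).card = 2 →
      (∃ B ∈ membersIn M (Uq M 5 3) G, (G \ clF M B).card = 1) → LocalShadowHall M 3 G) :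
    ShadowHall M 5 3 (((3 : ℕ) + 2 : ℚ) / ((3 : ℕ) + 1 : ℚ)) := by
  apply shadowHall_five_three_of_two hrk
  intro G hG hd
  by_cases h : ∃ B ∈ membersIn M (Uq M 5 3) G, (G \ clF M B).card = 1
  · exact h21 G hG hd h
  · push Not at h
    apply localShadowHall_two_two hl hG hd
    intro B hB
    have h1 := h B hB
    have h2 := one_le_card_sdiff_clF hG (mem_membersIn.1 hB).1
    omega

/-! ## The distance-`1` form of the local condition -/

open scoped Classical in
/-- The distance-`1` shadow sets of a family at `G`: shadow sets containing a member of the family with at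
most one extra element (`S = B` or `S = B ∪ {z}`). -/
noncomputable def shadowAt1 (M : Matroid α) [M.Finite] (q : ℕ) (𝒜 : Finset (Finset α)) (G : Finset α) :
    Finset (Finset α) :=
  (shadowAt M (q + 2) q 𝒜 G).filter (fun S => ∃ B ∈ membersIn M 𝒜 G, B ⊆ S ∧ (S \ B).card ≤ 1)

open scoped Classical in
/-- **The distance-`1` local form implies the local form**: counting only the shadow sets at distance `≤ 1`
from the family is a stronger Hall condition. -/
theorem localShadowHall_of_dist1 {q : ℕ} {G : Finset α}
    (h : ∀ 𝒜 ⊆ Uq M (q + 2) q, ((q : ℚ) + 2) / ((q : ℚ) + 1) * ∑ B ∈ membersIn M 𝒜 G, localWeight M B G ≤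
      ((shadowAt1 M q 𝒜 G).card : ℚ)) :
    LocalShadowHall M q G := by
  intro 𝒜 h𝒜
  refine le_trans (h 𝒜 h𝒜) ?_
  exact_mod_cast Finset.card_filter_le _ _

open scoped Classical in
/-- **The `(5, 3)` shadow form modulo the distance-`1` local form at the type `(2, 1)`** (the plane statement
(T21) at distance `1`, NIGHT-2-local.md §19 ADDENDUM 5). -/
theorem shadowHall_five_three_of_two_one_dist1 (hl : ∀ e ∈ gr M, M.IsNonloop e)
    (hrk : M.eRk ((gr M : Finset α) : Set α) = ((5 : ℕ) : ℕ∞))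
    (h21 : ∀ G ∈ flatsQ M 4, (gr M \ G).card = 2 →
      (∃ B ∈ membersIn M (Uq M 5 3) G, (G \ clF M B).card = 1) →
      ∀ 𝒜 ⊆ Uq M 5 3, (((3 : ℕ) : ℚ) + 2) / (((3 : ℕ) : ℚ) + 1) * ∑ B ∈ membersIn M 𝒜 G, localWeight M B G ≤
        ((shadowAt1 M 3 𝒜 G).card : ℚ)) :
    ShadowHall M 5 3 (((3 : ℕ) + 2 : ℚ) / ((3 : ℕ) + 1 : ℚ)) :=
  shadowHall_five_three_of_two_one hl hrk
    (fun G hG hd hex => localShadowHall_of_dist1 (h21 G hG hd hex))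

end PercRepro.Shadow
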